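import Literature.Analysis.FluidPDE.NSLocalAnalyticityRadiusProfile
import Literature.Analysis.FluidPDE.OseenPotentialDeformedBoundLocal
import Literature.Analysis.FluidPDE.OseenFlatComplexHolomorphy
import Literature.Analysis.FluidPDE.OseenPicardData
import Literature.Analysis.Complex.LocallyUniformLimitSCV
import HarnessLib

/-!
# Bradshaw–Grujić–Kukavica local analyticity radius: the contour Picard scheme

Analysis/FluidPDE definitions-layer file (namespace `Literature.Analysis.FluidPDE.BGK2015`) for
the proof of the named fact
`Literature.Analysis.FluidPDE.bradshawGrujicKukavica2015_local_analyticity_radius`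
(Bradshaw–Grujić–Kukavica 2015, Thm. 2.3; Grujić–Kukavica 1998). Given an abstract datum —
a bounded measurable real `DATA` on the slab `(s₀, t₁) × ℝ³` with a complex continuation `DATA_ℂ`
holomorphic and bounded on the growing profile regions
`Ω_t = profileRegion (c√(t-s₀) ψ)` and restricting to `DATA` at real points — we run the
complexified Picard scheme

  `W⁰ = 0`,  `Wⁿ⁺¹(t, ζ) = DATA_ℂ(t, ζ) - B^♭_{s₀}(wⁿ, wⁿ)(t, ζ)`,  `wⁿ = oseenPicard s₀ DATA n`,

(`picardW`), where `B^♭ = oseenDuhamelFlatC` is the *flat* continuation (real contour) of the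
Oseen bilinear term, and prove by induction (`picardW_spec`):

* `Wⁿ(s, ·)` is holomorphic on `Ω_s`, bounded there by `ρ₀`, and `Wⁿ(s, cx x) = cx wⁿ(s, x)`;
  the key step is the **deformed-contour bound for the flat slices**
  `‖oseenFlatC √(t-s) (wⁿ s) (wⁿ s) ζ‖ ≤ (1+L) C ρ₀²/√(t-s)` for `ζ ∈ Ω_t` (`norm_oseenFlatC_le_of_region`:
  the localised deformed bound `exists_norm_integral_oseenKernelC_flat_le_local` with the
  adapted profile of `NSLocalAnalyticityRadiusProfile.lean` and the piecewise holomorphic/real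
  extension `regionExt` of the densities);
* consecutive differences contract (`norm_picardW_succ_sub_le`), so `Wⁿ(t, ·)` converges
  uniformly on `Ω_t` to a holomorphic `W(t, ·)` (`picardWLim`, Weierstrass' theorem in several
  variables) with `W(t, cx x) = cx v(t, x)` for the bounded fixed point `v = DATA - B(v, v)`
  (`exists_differentiableOn_region_of_fixedPoint`).

## References

* Z. Bradshaw, Z. Grujić, I. Kukavica, J. Differential Equations 259 (2015), Thm. 2.3, §3–§4.
  [BradshawGrujicKukavica2015]
* Z. Grujić, I. Kukavica, J. Funct. Anal. 152 (1998), 447–466. [GrujicKukavica1998]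
* L. Hörmander, *An Introduction to Complex Analysis in Several Variables* (1973), Cor. 2.2.5.
  [HormanderSCV1973]
-/

noncomputable section

open MeasureTheory Set Function Filter Metric Real
open _root_.Topology
open scoped ENNReal ContDiff InnerProductSpace RealInnerProductSpace
open Literature.Analysis.FunctionSpaces.EuclideanSpace (complexify complexify_apply norm_complexify
  complexify_injective continuous_complexify)

namespace Literature.Analysis.FluidPDE

namespace BGK2015

/-! ### Real parts and the piecewise extension of the densities -/

/-- The coordinatewise real part `Re : ℂ³ → ℝ³`. [folklore] -/
def reVec (ζ : EuclideanSpace ℂ (Fin 3)) : EuclideanSpace ℝ (Fin 3) := WithLp.toLp 2 fun i => (ζ i).re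

/-- `Re (cx x + i cx y) = x`. [folklore] -/
theorem reVec_complexify_add_I_smul (x y : EuclideanSpace ℝ (Fin 3)) :
    reVec (complexify x + Complex.I • complexify y) = x := by
  ext i
  exact re_complexify_add_I_smul_complexify_apply x y i

/-- `Re (cx x) = x`. [folklore] -/
theorem reVec_complexify (x : EuclideanSpace ℝ (Fin 3)) : reVec (complexify x) = x := by
  have h := reVec_complexify_add_I_smul x 0
  rwa [map_zero, smul_zero, add_zero] at h

open Classical in
/-- **The piecewise extension of a density**: `W` on the region `Ω`, the real field lifted through
the real part elsewhere. [folklore] -/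
def regionExt (Ω : Set (EuclideanSpace ℂ (Fin 3))) (W : EuclideanSpace ℂ (Fin 3) → EuclideanSpace ℂ (Fin 3))
    (w : EuclideanSpace ℝ (Fin 3) → EuclideanSpace ℝ (Fin 3)) (ζ : EuclideanSpace ℂ (Fin 3)) :
    EuclideanSpace ℂ (Fin 3) :=
  if ζ ∈ Ω then W ζ else complexify (w (reVec ζ))

/-- Unfolding on the region. [folklore] -/
theorem regionExt_of_mem {Ω : Set (EuclideanSpace ℂ (Fin 3))} {W : EuclideanSpace ℂ (Fin 3) → EuclideanSpace ℂ (Fin 3)}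
    {w : EuclideanSpace ℝ (Fin 3) → EuclideanSpace ℝ (Fin 3)} {ζ : EuclideanSpace ℂ (Fin 3)} (h : ζ ∈ Ω) :
    regionExt Ω W w ζ = W ζ := by
  simp [regionExt, h]

/-- Unfolding off the region. [folklore] -/
theorem regionExt_of_notMem {Ω : Set (EuclideanSpace ℂ (Fin 3))} {W : EuclideanSpace ℂ (Fin 3) → EuclideanSpace ℂ (Fin 3)}
    {w : EuclideanSpace ℝ (Fin 3) → EuclideanSpace ℝ (Fin 3)} {ζ : EuclideanSpace ℂ (Fin 3)} (h : ζ ∉ Ω) :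
    regionExt Ω W w ζ = complexify (w (reVec ζ)) := by
  simp [regionExt, h]

/-- The extension is holomorphic on the (open) region when `W` is. [folklore] -/
theorem differentiableOn_regionExt {Ω : Set (EuclideanSpace ℂ (Fin 3))} (hΩ : IsOpen Ω)
    {W : EuclideanSpace ℂ (Fin 3) → EuclideanSpace ℂ (Fin 3)} (hW : DifferentiableOn ℂ W Ω)
    (w : EuclideanSpace ℝ (Fin 3) → EuclideanSpace ℝ (Fin 3)) : DifferentiableOn ℂ (regionExt Ω W w) Ω := by
  have _ := hΩ
  exact hW.congr fun ζ hζ => regionExt_of_mem hζ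

/-- The extension has the prescribed real trace when `W` restricts to `w` at the real points of
the region. [folklore] -/
theorem regionExt_complexify {Ω : Set (EuclideanSpace ℂ (Fin 3))} {W : EuclideanSpace ℂ (Fin 3) → EuclideanSpace ℂ (Fin 3)}
    {w : EuclideanSpace ℝ (Fin 3) → EuclideanSpace ℝ (Fin 3)} (hres : ∀ x, complexify x ∈ Ω → W (complexify x) = complexify (w x))
    (x : EuclideanSpace ℝ (Fin 3)) : regionExt Ω W w (complexify x) = complexify (w x) := by
  by_cases h : complexify x ∈ Ω
  · rw [regionExt_of_mem h, hres x h]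
  · rw [regionExt_of_notMem h, reVec_complexify]

/-- The extension is bounded by a common bound of `W` on the region and of `w`. [folklore] -/
theorem norm_regionExt_le {Ω : Set (EuclideanSpace ℂ (Fin 3))} {W : EuclideanSpace ℂ (Fin 3) → EuclideanSpace ℂ (Fin 3)}
    {w : EuclideanSpace ℝ (Fin 3) → EuclideanSpace ℝ (Fin 3)} {M : ℝ} (hW : ∀ ζ ∈ Ω, ‖W ζ‖ ≤ M) (hw : ∀ x, ‖w x‖ ≤ M)
    (ζ : EuclideanSpace ℂ (Fin 3)) : ‖regionExt Ω W w ζ‖ ≤ M := by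
  by_cases h : ζ ∈ Ω
  · rw [regionExt_of_mem h]; exact hW ζ h
  · rw [regionExt_of_notMem h, norm_complexify]; exact hw _

/-! ### Integrability of the flat integrand at a complex point -/

/-- **The flat Oseen integrand of bounded measurable densities is integrable** at every complex
point `cx x + i cx y` (`ρ > 0`): compact bound near `x`, sector bound beyond `2‖y‖ + 3`.
[folklore] -/
theorem integrable_oseenFlatC_integrand {u v : EuclideanSpace ℝ (Fin 3) → EuclideanSpace ℝ (Fin 3)}
    (hu : AEStronglyMeasurable u volume) (hv : AEStronglyMeasurable v volume)
    {Mu Mv : ℝ} (hMu : 0 ≤ Mu) (hMv : 0 ≤ Mv) (huM : ∀ w, ‖u w‖ ≤ Mu) (hvM : ∀ w, ‖v w‖ ≤ Mv)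
    {ρ : ℝ} (hρ : 0 < ρ) (x y : EuclideanSpace ℝ (Fin 3)) :
    Integrable fun w => oseenKernelC (ρ : ℂ) (complexify x + Complex.I • complexify y - complexify w)
      (complexify (u w)) (complexify (v w)) := by
  set d : ℝ := (Module.finrank ℝ (EuclideanSpace ℝ (Fin 3)) : ℝ) with hd
  obtain ⟨C, hC, hK⟩ := exists_norm_oseenKernelC_imShift_le (ι := Fin 3)
  obtain ⟨B, hB0, hB⟩ := exists_forall_norm_oseenKernelC_le_of_isCompact hρ.ne'
    (isCompact_singleton (x := complexify x + Complex.I • complexify y)) x (2 * ‖y‖ + 3) Mu Mv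
  set tail : EuclideanSpace ℝ (Fin 3) → ℝ := fun w =>
    (25 / 6 * ρ ^ 2 + ‖x - w‖ ^ 2 / 4) ^ (-((d + 1) / 2)) with htail
  have hmaj : Integrable fun w => (closedBall x (2 * ‖y‖ + 3)).indicator (fun _ => B) w + C * tail w * Mu * Mv := by
    refine ((integrable_indicator_iff measurableSet_closedBall).2
      (integrableOn_const (isCompact_closedBall _ _).measure_lt_top.ne)).add ?_
    have ht := integrable_sector_tail (ι := Fin 3) (show (0 : ℝ) < 25 / 6 * ρ ^ 2 by positivity) x
    rw [← hd] at ht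
    have ht' : Integrable (fun w => C * Mu * Mv * tail w) := ht.const_mul _
    exact ht'.congr (Eventually.of_forall fun w => by ring)
  refine hmaj.mono' (aestronglyMeasurable_oseenFlatC_integrand hu hv hρ.ne' _) (Eventually.of_forall fun w => ?_)
  by_cases hw : w ∈ closedBall x (2 * ‖y‖ + 3)
  · rw [Set.indicator_of_mem hw]
    have h1 := hB _ (mem_singleton _) w hw (complexify (u w)) (by rw [norm_complexify]; exact huM w)
      (complexify (v w)) (by rw [norm_complexify]; exact hvM w)
    have h2 : 0 ≤ C * tail w * Mu * Mv := by
      have : 0 ≤ tail w := Real.rpow_nonneg (by positivity) _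
      positivity
    linarith
  · rw [Set.indicator_of_notMem hw, zero_add]
    have hfar : 2 * ‖y‖ + 3 < ‖x - w‖ := by
      have : ¬ dist w x ≤ 2 * ‖y‖ + 3 := hw
      rw [dist_eq_norm, ← norm_neg, neg_sub] at this
      linarith
    have hadm' : ‖-y‖ ≤ ‖x - w‖ / 2 + ρ := by rw [norm_neg]; linarith
    rw [complexify_add_I_smul_sub']
    have hKw := hK hρ hadm' (complexify (u w)) (complexify (v w))
    rw [← hd, norm_complexify, norm_complexify] at hKw
    refine hKw.trans ?_
    have hpow : (25 / 6 * ρ ^ 2 + ‖x - w‖ ^ 2) ^ (-((d + 1) / 2)) ≤ tail w := by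
      rw [htail]
      refine Real.rpow_le_rpow_of_nonpos (by positivity) ?_ (by
        have : (0 : ℝ) ≤ d := by rw [hd]; positivity
        linarith)
      nlinarith [norm_nonneg (x - w)]
    have h1 : C * (25 / 6 * ρ ^ 2 + ‖x - w‖ ^ 2) ^ (-((d + 1) / 2)) * ‖u w‖ * ‖v w‖ ≤ C * tail w * Mu * Mv := by
      gcongr
      · exact huM w
      · exact hvM w
    exact h1

/-! ### The regions and the deformed-contour bound for flat slices -/

/-- **The growing complex region** at time `s` from the base `s₀` with aperture `c`:
`Ω_s = profileRegion (c√(s - s₀) ψ)`. [cite: GrujicKukavica1998, §2] -/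
def region (x₁ : EuclideanSpace ℝ (Fin 3)) (c s₀ s : ℝ) : Set (EuclideanSpace ℂ (Fin 3)) :=
  profileRegion fun x => (c * Real.sqrt (s - s₀)) * bump2 x₁ x

/-- The region is open. [folklore] -/
theorem isOpen_region (x₁ : EuclideanSpace ℝ (Fin 3)) (c s₀ s : ℝ) : IsOpen (region x₁ c s₀ s) :=
  isOpen_profileRegion (continuous_const.mul (bump2_contDiff x₁ (n := 0)).continuous)

/-- Decomposition of a point of the region. [folklore] -/
theorem mem_region {x₁ : EuclideanSpace ℝ (Fin 3)} {c s₀ s : ℝ} {ζ : EuclideanSpace ℂ (Fin 3)}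
    (hζ : ζ ∈ region x₁ c s₀ s) :
    ∃ x y : EuclideanSpace ℝ (Fin 3), ζ = complexify x + Complex.I • complexify y ∧ x ∈ ball x₁ 2 ∧
      0 < bump2 x₁ x ∧ ‖y‖ < (c * Real.sqrt (s - s₀)) * bump2 x₁ x ∧ ‖y‖ < c * Real.sqrt (s - s₀) ∧
      0 < c * Real.sqrt (s - s₀) :=
  mem_profileRegion_bump2 hζ

/-- **The deformed-contour bound for the flat Oseen slice of region-continuable densities.**
Let `C` be the constant of `exists_norm_integral_oseenKernelC_flat_le_local` (`n + 1 = 3`),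
`L₀` a Lipschitz/gradient bound of the bump, `C_H` a bound for `|H'|`; `0 < c ≤ 1`,
`c L₀ √T ≤ 1/4`, `s₀ < s < t`, `t - s₀ ≤ T`. If the bounded measurable real densities `u, v`
(bounds `M_u, M_v` everywhere; no measurability is needed — a non-integrable flat integrand has
flat integral `0`) have continuations `U, V` holomorphic on `Ω_s`, bounded there by
`M_u, M_v`, with `U (cx x) = cx (u x)` at the real points of `Ω_s` (and likewise `V`), then at
every `ζ ∈ Ω_t`,
`‖oseenFlatC √(t-s) u v ζ‖ ≤ (1 + c√T L₀(1 + 2C_H)) · C M_u M_v / √(t-s)`.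
[cite: BradshawGrujicKukavica2015, §3 Lemma 3.2 (the mechanism, in contour form)] -/
theorem norm_oseenFlatC_le_of_region {C : ℝ}
    (hC : ∀ {ρ : ℝ}, 0 < ρ → ∀ (x y : EuclideanSpace ℝ (Fin 3))
      {Ω : Set (EuclideanSpace ℂ (Fin 3))}, IsOpen Ω →
      ∀ {A B : EuclideanSpace ℂ (Fin 3) → EuclideanSpace ℂ (Fin 3)},
        DifferentiableOn ℂ A Ω → DifferentiableOn ℂ B Ω →
      ∀ {φ : EuclideanSpace ℝ (Fin 3) → ℝ}, ContDiff ℝ 1 φ → HasCompactSupport φ →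
      ∀ {U₀ : Set (EuclideanSpace ℝ (Fin 3))}, IsOpen U₀ → Convex ℝ U₀ → tsupport φ ⊆ U₀ →
      ∀ {L : ℝ}, 0 ≤ L → (∀ w, |fderiv ℝ φ w y| ≤ L) →
      (∀ w ∈ U₀, ∀ θ ∈ Icc (0 : ℝ) 1, complexify w + Complex.I • complexify ((θ * φ w) • y) ∈ Ω) →
      (∀ w, ‖(φ w - 1) • y‖ ≤ ‖x - w‖ / 2 + ρ) →
      ∀ {MA MB : ℝ}, 0 ≤ MA → 0 ≤ MB →
        (∀ w, ‖A (complexify w + Complex.I • complexify (φ w • y))‖ ≤ MA) →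
        (∀ w, ‖B (complexify w + Complex.I • complexify (φ w • y))‖ ≤ MB) →
        Integrable (fun w => oseenKernelC (ρ : ℂ) (complexify x + Complex.I • complexify y - complexify w)
          (A (complexify w)) (B (complexify w))) →
        ‖∫ w, oseenKernelC (ρ : ℂ) (complexify x + Complex.I • complexify y - complexify w)
            (A (complexify w)) (B (complexify w))‖ ≤ (1 + L) * (C * MA * MB / ρ))
    (hCnn : 0 ≤ C)
    {L₀ C_H : ℝ} (hL₀0 : 0 < L₀) (hL₀ : ∀ x₁ x : EuclideanSpace ℝ (Fin 3), ‖fderiv ℝ (bump2 x₁) x‖ ≤ L₀)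
    (hLip : ∀ x₁ x w : EuclideanSpace ℝ (Fin 3), |bump2 x₁ x - bump2 x₁ w| ≤ L₀ * ‖x - w‖)
    (hCH0 : 0 ≤ C_H) (hCH : ∀ r, |deriv stepH r| ≤ C_H)
    {x₁ : EuclideanSpace ℝ (Fin 3)} {c T s₀ s t : ℝ} (hc : 0 < c) (hc1 : c ≤ 1) (hcL : c * L₀ * Real.sqrt T ≤ 1 / 4)
    (hs : s₀ < s) (hst : s < t) (htT : t - s₀ ≤ T)
    {u v : EuclideanSpace ℝ (Fin 3) → EuclideanSpace ℝ (Fin 3)}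
    {Mu Mv : ℝ} (hMu0 : 0 ≤ Mu) (hMv0 : 0 ≤ Mv) (huM : ∀ w, ‖u w‖ ≤ Mu) (hvM : ∀ w, ‖v w‖ ≤ Mv)
    {U V : EuclideanSpace ℂ (Fin 3) → EuclideanSpace ℂ (Fin 3)}
    (hU : DifferentiableOn ℂ U (region x₁ c s₀ s)) (hV : DifferentiableOn ℂ V (region x₁ c s₀ s))
    (hUM : ∀ ζ ∈ region x₁ c s₀ s, ‖U ζ‖ ≤ Mu) (hVM : ∀ ζ ∈ region x₁ c s₀ s, ‖V ζ‖ ≤ Mv)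
    (hUres : ∀ x, complexify x ∈ region x₁ c s₀ s → U (complexify x) = complexify (u x))
    (hVres : ∀ x, complexify x ∈ region x₁ c s₀ s → V (complexify x) = complexify (v x))
    {ζ : EuclideanSpace ℂ (Fin 3)} (hζ : ζ ∈ region x₁ c s₀ t) :
    ‖oseenFlatC (Real.sqrt (t - s)) u v ζ‖ ≤
      (1 + c * Real.sqrt T * L₀ * (1 + 2 * C_H)) * (C * Mu * Mv / Real.sqrt (t - s)) := by
  obtain ⟨x, y, rfl, hx, hψx, hyψ, hyκ, hκt⟩ := mem_region hζ
  -- parameters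
  have hts : 0 < t - s := sub_pos.2 hst
  have hρ : 0 < Real.sqrt (t - s) := Real.sqrt_pos.2 hts
  have hss₀ : 0 < s - s₀ := sub_pos.2 hs
  have hts₀ : 0 < t - s₀ := by linarith
  set κs : ℝ := c * Real.sqrt (s - s₀) with hκs
  set κt : ℝ := c * Real.sqrt (t - s₀) with hκt'
  have hκs0 : 0 < κs := by positivity
  have hκt0 : 0 < κt := by positivity
  set lam : ℝ := κs / (κt * bump2 x₁ x) with hlam
  have hlam0 : 0 < lam := by positivity
  set φ : EuclideanSpace ℝ (Fin 3) → ℝ := adaptedProfile x₁ x lam with hφ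
  -- the extensions
  set A := regionExt (region x₁ c s₀ s) U u with hA
  set B := regionExt (region x₁ c s₀ s) V v with hB
  have hAd : DifferentiableOn ℂ A (region x₁ c s₀ s) := differentiableOn_regionExt (isOpen_region _ _ _ _) hU u
  have hBd : DifferentiableOn ℂ B (region x₁ c s₀ s) := differentiableOn_regionExt (isOpen_region _ _ _ _) hV v
  have hAres : ∀ w, A (complexify w) = complexify (u w) := regionExt_complexify hUres
  have hBres : ∀ w, B (complexify w) = complexify (v w) := regionExt_complexify hVres
  have hAb : ∀ ξ, ‖A ξ‖ ≤ Mu := norm_regionExt_le hUM huM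
  have hBb : ∀ ξ, ‖B ξ‖ ≤ Mv := norm_regionExt_le hVM hvM
  -- the profile data
  have hφ1 : ContDiff ℝ 1 φ := adaptedProfile_contDiff x₁ x lam
  have hφc : HasCompactSupport φ := hasCompactSupport_adaptedProfile hψx
  have hφsupp : tsupport φ ⊆ ball x₁ 2 := tsupport_adaptedProfile_subset_ball hψx
  have hsqT : Real.sqrt (s - s₀) ≤ Real.sqrt T := Real.sqrt_le_sqrt (by linarith)
  set L : ℝ := c * Real.sqrt T * L₀ * (1 + 2 * C_H) with hLdef
  have hL0 : 0 ≤ L := by positivity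
  have hlamy : lam * ‖y‖ ≤ κs := by
    rw [hlam, div_mul_eq_mul_div, div_le_iff₀ (by positivity)]
    exact mul_le_mul_of_nonneg_left hyψ.le hκs0.le
  have hDφ : ∀ w, |fderiv ℝ φ w y| ≤ L := by
    intro w
    have h := abs_fderiv_adaptedProfile_le hψx hlam0.le (hL₀ x₁) hCH0 hCH hlamy w
    refine h.trans ?_
    rw [hLdef, hκs]
    have : c * Real.sqrt (s - s₀) ≤ c * Real.sqrt T := mul_le_mul_of_nonneg_left hsqT hc.le
    have hL₀' : 0 ≤ L₀ * (1 + 2 * C_H) := by positivity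
    nlinarith
  have hsweep : ∀ w ∈ ball x₁ 2, ∀ θ ∈ Icc (0 : ℝ) 1,
      complexify w + Complex.I • complexify ((θ * φ w) • y) ∈ region x₁ c s₀ s :=
    fun w hw θ hθ => adaptedProfile_graph_mem hψx hκs0 hκt0 rfl hyψ hw hθ
  have hresid : ∀ w, ‖(φ w - 1) • y‖ ≤ ‖x - w‖ / 2 + Real.sqrt (t - s) :=
    adaptedProfile_residual_le hψx (hLip x₁) hc hc1 hcL hs hst htT rfl hyψ
  -- if the flat integrand is not integrable the flat integral is the junk value `0`
  by_cases hint : Integrable fun w => oseenKernelC ((Real.sqrt (t - s) : ℝ) : ℂ)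
      (complexify x + Complex.I • complexify y - complexify w) (complexify (u w)) (complexify (v w))
  swap
  · rw [oseenFlatC_apply, integral_undef hint, norm_zero]
    positivity
  -- the flat integral is the contour-ready integral
  have heq : oseenFlatC (Real.sqrt (t - s)) u v (complexify x + Complex.I • complexify y) =
      ∫ w, oseenKernelC ((Real.sqrt (t - s) : ℝ) : ℂ) (complexify x + Complex.I • complexify y - complexify w)
        (A (complexify w)) (B (complexify w)) := by
    rw [oseenFlatC_apply]
    exact integral_congr_ae (Eventually.of_forall fun w => by simp only [hAres, hBres])
  have hint' : Integrable fun w => oseenKernelC ((Real.sqrt (t - s) : ℝ) : ℂ)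
      (complexify x + Complex.I • complexify y - complexify w) (A (complexify w)) (B (complexify w)) :=
    hint.congr (Eventually.of_forall fun w => by simp only [hAres, hBres])
  rw [heq]
  exact hC hρ x y (isOpen_region _ _ _ _) hAd hBd hφ1 hφc isOpen_ball (convex_ball _ _) hφsupp hL0 hDφ
    hsweep hresid hMu0 hMv0 (fun w => hAb _) (fun w => hBb _) hint'

/-! ### The scheme -/

/-- **The complex Picard iterates**: `W⁰ = 0`,
`Wⁿ⁺¹(t, ζ) = DATA_ℂ(t, ζ) - B^♭_{s₀}(wⁿ, wⁿ)(t, ζ)` with the real iterates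
`wⁿ = oseenPicard s₀ DATA n`. [cite: BradshawGrujicKukavica2015, §4] -/
def picardW (s₀ : ℝ) (DATA : ℝ → EuclideanSpace ℝ (Fin 3) → EuclideanSpace ℝ (Fin 3))
    (DATAC : ℝ → EuclideanSpace ℂ (Fin 3) → EuclideanSpace ℂ (Fin 3)) :
    ℕ → ℝ → EuclideanSpace ℂ (Fin 3) → EuclideanSpace ℂ (Fin 3)
  | 0 => fun _ _ => 0
  | n + 1 => fun t ζ => DATAC t ζ -
      oseenDuhamelFlatC s₀ (oseenPicard s₀ DATA n) (oseenPicard s₀ DATA n) t ζ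

/-- Unfolding lemma (`n = 0`). [folklore] -/
@[simp] theorem picardW_zero (s₀ : ℝ) (DATA : ℝ → EuclideanSpace ℝ (Fin 3) → EuclideanSpace ℝ (Fin 3))
    (DATAC : ℝ → EuclideanSpace ℂ (Fin 3) → EuclideanSpace ℂ (Fin 3)) (t : ℝ) (ζ : EuclideanSpace ℂ (Fin 3)) :
    picardW s₀ DATA DATAC 0 t ζ = 0 := rfl

/-- Unfolding lemma (successor). [folklore] -/
theorem picardW_succ (s₀ : ℝ) (DATA : ℝ → EuclideanSpace ℝ (Fin 3) → EuclideanSpace ℝ (Fin 3))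
    (DATAC : ℝ → EuclideanSpace ℂ (Fin 3) → EuclideanSpace ℂ (Fin 3)) (n : ℕ) (t : ℝ) (ζ : EuclideanSpace ℂ (Fin 3)) :
    picardW s₀ DATA DATAC (n + 1) t ζ = DATAC t ζ -
      oseenDuhamelFlatC s₀ (oseenPicard s₀ DATA n) (oseenPicard s₀ DATA n) t ζ := rfl

/-- **The hypotheses on the datum of the contour scheme**: `DATA` jointly measurable and bounded
by `D₀` on the slab, `DATA_ℂ(t, ·)` holomorphic on `Ω_t` and bounded there by `D₀'`, restricting
to `DATA(t, ·)` at all real points. [folklore] -/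
structure IsSchemeDatum (x₁ : EuclideanSpace ℝ (Fin 3)) (c s₀ t₁ D₀ D₀' : ℝ)
    (DATA : ℝ → EuclideanSpace ℝ (Fin 3) → EuclideanSpace ℝ (Fin 3))
    (DATAC : ℝ → EuclideanSpace ℂ (Fin 3) → EuclideanSpace ℂ (Fin 3)) : Prop where
  /-- Joint measurability of `DATA` on the slab. -/
  meas : AEStronglyMeasurable (uncurry DATA)
    ((volume : Measure (ℝ × EuclideanSpace ℝ (Fin 3))).restrict (Ioo s₀ t₁ ×ˢ univ))
  /-- `0 ≤ D₀`. -/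
  nonneg : 0 ≤ D₀
  /-- `‖DATA‖ ≤ D₀` on the slab. -/
  bound : ∀ t ∈ Ioo s₀ t₁, ∀ x, ‖DATA t x‖ ≤ D₀
  /-- `0 ≤ D₀'`. -/
  nonneg' : 0 ≤ D₀'
  /-- `‖DATA_ℂ(t, ·)‖ ≤ D₀'` on `Ω_t`. -/
  boundC : ∀ t ∈ Ioo s₀ t₁, ∀ ζ ∈ region x₁ c s₀ t, ‖DATAC t ζ‖ ≤ D₀'
  /-- `DATA_ℂ(t, ·)` is holomorphic on `Ω_t`. -/
  holo : ∀ t ∈ Ioo s₀ t₁, DifferentiableOn ℂ (DATAC t) (region x₁ c s₀ t)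
  /-- `DATA_ℂ(t, cx x) = cx DATA(t, x)`. -/
  real : ∀ t ∈ Ioo s₀ t₁, ∀ x, DATAC t (complexify x) = complexify (DATA t x)

/-- `τ ↦ (t - τ)^{-1/2}` is integrable on `(s, t)` (private copy). [folklore] -/
private theorem integrableOn_Ioo_sub_rpow_neg_half' (s t : ℝ) :
    IntegrableOn (fun τ => (t - τ) ^ (-(1 / 2 : ℝ))) (Ioo s t) := by
  have hii : IntervalIntegrable (fun τ => (t - τ) ^ (-(1 / 2 : ℝ))) volume s t := by
    have h := (intervalIntegral.intervalIntegrable_rpow' (a := 0) (b := t - s)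
      (by norm_num : (-1 : ℝ) < -(1 / 2))).comp_sub_left t
    simp only [sub_zero, sub_sub_cancel] at h
    exact h.symm
  exact (hii.1 : IntegrableOn _ (Ioc s t) _).mono_set Ioo_subset_Ioc_self

/-- `1/√τ = τ^{-1/2}` for `τ > 0` (private copy). [folklore] -/
private theorem inv_sqrt_eq_rpow_neg_half' {τ : ℝ} (hτ : 0 < τ) : (Real.sqrt τ)⁻¹ = τ ^ (-(1 / 2 : ℝ)) := by
  rw [Real.sqrt_eq_rpow, Real.rpow_neg hτ.le]

/-- The real parts of two decomposed points differ by at most the distance of the points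
(private copy). [folklore] -/
private theorem norm_re_sub_re_le' (x y x' y' : EuclideanSpace ℝ (Fin 3)) :
    ‖x - x'‖ ≤ ‖(complexify x + Complex.I • complexify y) - (complexify x' + Complex.I • complexify y')‖ := by
  have heq : (complexify x + Complex.I • complexify y) - (complexify x' + Complex.I • complexify y') =
      complexify (x - x') + Complex.I • complexify (y - y') := by
    rw [map_sub, map_sub, smul_sub]; abel
  rw [heq]
  refine norm_le_of_forall_abs_le_norm_apply fun i => ?_
  rw [← re_complexify_add_I_smul_complexify_apply (x - x') (y - y') i]
  exact Complex.abs_re_le_norm _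

section Run

/-- **The data of a run of the contour scheme**: the datum hypotheses, the real bilinear sup bound
(constant `C_B`) and its smallness, the deformed-contour constant `C`, the profile constants
`L₀, C_H`, the aperture `0 < c ≤ 1` with `c L₀ √(t₁ - s₀) ≤ 1/4`, and the complex radius `ρ₀`
with `2D₀ ≤ ρ₀`, `D₀' + Λρ₀² 2√(t₁-s₀) ≤ ρ₀`, `Λρ₀ 2√(t₁-s₀) ≤ 1/8`
(`Λ = (1 + c√(t₁-s₀) L₀(1+2C_H)) C`). [folklore] -/
structure IsSchemeRun (x₁ : EuclideanSpace ℝ (Fin 3)) (c s₀ t₁ D₀ D₀' : ℝ)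
    (DATA : ℝ → EuclideanSpace ℝ (Fin 3) → EuclideanSpace ℝ (Fin 3))
    (DATAC : ℝ → EuclideanSpace ℂ (Fin 3) → EuclideanSpace ℂ (Fin 3)) (C_B C L₀ C_H ρ₀ : ℝ) : Prop where
  /-- The datum hypotheses. -/
  datum : IsSchemeDatum x₁ c s₀ t₁ D₀ D₀' DATA DATAC
  /-- `0 < C_B`. -/
  hCB0 : 0 < C_B
  /-- The real bilinear sup bound. -/
  hCB : ∀ {u v : ℝ → EuclideanSpace ℝ (Fin 3) → EuclideanSpace ℝ (Fin 3)} {s t Mu Mv : ℝ}, s < t →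
    0 ≤ Mu → 0 ≤ Mv → (∀ τ ∈ Ioo s t, ∀ y, ‖u τ y‖ ≤ Mu) → (∀ τ ∈ Ioo s t, ∀ y, ‖v τ y‖ ≤ Mv) → ∀ x,
      ‖oseenDuhamel 1 s u v t x‖ ≤ C_B * Mu * Mv * (1 : ℝ) ^ (-(1 / 2 : ℝ)) * (2 * Real.sqrt (t - s))
  /-- Smallness for the real scheme. -/
  hsmallR : C_B * (2 * D₀) * (2 * Real.sqrt (t₁ - s₀)) ≤ 1 / 4
  /-- `0 < C`. -/
  hC0 : 0 < C
  /-- The deformed-contour bound. -/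
  hC : ∀ {ρ : ℝ}, 0 < ρ → ∀ (x y : EuclideanSpace ℝ (Fin 3))
    {Ω : Set (EuclideanSpace ℂ (Fin 3))}, IsOpen Ω →
    ∀ {A B : EuclideanSpace ℂ (Fin 3) → EuclideanSpace ℂ (Fin 3)},
      DifferentiableOn ℂ A Ω → DifferentiableOn ℂ B Ω →
    ∀ {φ : EuclideanSpace ℝ (Fin 3) → ℝ}, ContDiff ℝ 1 φ → HasCompactSupport φ →
    ∀ {U₀ : Set (EuclideanSpace ℝ (Fin 3))}, IsOpen U₀ → Convex ℝ U₀ → tsupport φ ⊆ U₀ →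
    ∀ {L : ℝ}, 0 ≤ L → (∀ w, |fderiv ℝ φ w y| ≤ L) →
    (∀ w ∈ U₀, ∀ θ ∈ Icc (0 : ℝ) 1, complexify w + Complex.I • complexify ((θ * φ w) • y) ∈ Ω) →
    (∀ w, ‖(φ w - 1) • y‖ ≤ ‖x - w‖ / 2 + ρ) →
    ∀ {MA MB : ℝ}, 0 ≤ MA → 0 ≤ MB →
      (∀ w, ‖A (complexify w + Complex.I • complexify (φ w • y))‖ ≤ MA) →
      (∀ w, ‖B (complexify w + Complex.I • complexify (φ w • y))‖ ≤ MB) →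
      Integrable (fun w => oseenKernelC (ρ : ℂ) (complexify x + Complex.I • complexify y - complexify w)
        (A (complexify w)) (B (complexify w))) →
      ‖∫ w, oseenKernelC (ρ : ℂ) (complexify x + Complex.I • complexify y - complexify w)
          (A (complexify w)) (B (complexify w))‖ ≤ (1 + L) * (C * MA * MB / ρ)
  /-- `0 < L₀`. -/
  hL₀0 : 0 < L₀
  /-- Gradient bound of the bump. -/
  hL₀ : ∀ x₁ x : EuclideanSpace ℝ (Fin 3), ‖fderiv ℝ (bump2 x₁) x‖ ≤ L₀
  /-- Lipschitz bound of the bump. -/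
  hLip : ∀ x₁ x w : EuclideanSpace ℝ (Fin 3), |bump2 x₁ x - bump2 x₁ w| ≤ L₀ * ‖x - w‖
  /-- `0 ≤ C_H`. -/
  hCH0 : 0 ≤ C_H
  /-- Derivative bound of the step. -/
  hCH : ∀ r, |deriv stepH r| ≤ C_H
  /-- `s₀ < t₁`. -/
  hst₁ : s₀ < t₁
  /-- `0 < c`. -/
  hc : 0 < c
  /-- `c ≤ 1`. -/
  hc1 : c ≤ 1
  /-- Geometric smallness. -/
  hcL : c * L₀ * Real.sqrt (t₁ - s₀) ≤ 1 / 4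
  /-- `2D₀ ≤ ρ₀`. -/
  hρD : 2 * D₀ ≤ ρ₀
  /-- The complex radius absorbs the flat Duhamel term. -/
  hρ : D₀' + (1 + c * Real.sqrt (t₁ - s₀) * L₀ * (1 + 2 * C_H)) * C * ρ₀ ^ 2 * (2 * Real.sqrt (t₁ - s₀)) ≤ ρ₀
  /-- Contraction of the complex differences. -/
  hcontr : (1 + c * Real.sqrt (t₁ - s₀) * L₀ * (1 + 2 * C_H)) * C * ρ₀ * (2 * Real.sqrt (t₁ - s₀)) ≤ 1 / 8

variable {x₁ : EuclideanSpace ℝ (Fin 3)} {c s₀ t₁ D₀ D₀' : ℝ}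
  {DATA : ℝ → EuclideanSpace ℝ (Fin 3) → EuclideanSpace ℝ (Fin 3)}
  {DATAC : ℝ → EuclideanSpace ℂ (Fin 3) → EuclideanSpace ℂ (Fin 3)} {C_B C L₀ C_H ρ₀ : ℝ}
  (hR : IsSchemeRun x₁ c s₀ t₁ D₀ D₀' DATA DATAC C_B C L₀ C_H ρ₀)
include hR

/-- **The slices of continuable densities**, in the constants of the run: for `s₀ < s < t < t₁`…
precisely `t ≤ t₁`, densities bounded by `M_u, M_v` with continuations holomorphic on `Ω_s`,
bounded by `M_u, M_v` and with the right real traces, and `ζ ∈ Ω_t`: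
`‖oseenFlatC √(t-s) u v ζ‖ ≤ Λ M_u M_v (t - s)^{-1/2}`. [cite: BradshawGrujicKukavica2015, §3 Lemma 3.2] -/
theorem norm_slice_le {s t : ℝ} (hs : s₀ < s) (hst : s < t) (ht : t ≤ t₁)
    {u v : EuclideanSpace ℝ (Fin 3) → EuclideanSpace ℝ (Fin 3)} {Mu Mv : ℝ} (hMu0 : 0 ≤ Mu) (hMv0 : 0 ≤ Mv)
    (huM : ∀ w, ‖u w‖ ≤ Mu) (hvM : ∀ w, ‖v w‖ ≤ Mv)
    {U V : EuclideanSpace ℂ (Fin 3) → EuclideanSpace ℂ (Fin 3)}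
    (hU : DifferentiableOn ℂ U (region x₁ c s₀ s)) (hV : DifferentiableOn ℂ V (region x₁ c s₀ s))
    (hUM : ∀ ζ ∈ region x₁ c s₀ s, ‖U ζ‖ ≤ Mu) (hVM : ∀ ζ ∈ region x₁ c s₀ s, ‖V ζ‖ ≤ Mv)
    (hUres : ∀ x, complexify x ∈ region x₁ c s₀ s → U (complexify x) = complexify (u x))
    (hVres : ∀ x, complexify x ∈ region x₁ c s₀ s → V (complexify x) = complexify (v x))
    {ζ : EuclideanSpace ℂ (Fin 3)} (hζ : ζ ∈ region x₁ c s₀ t) :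
    ‖oseenFlatC (Real.sqrt (t - s)) u v ζ‖ ≤
      (1 + c * Real.sqrt (t₁ - s₀) * L₀ * (1 + 2 * C_H)) * C * Mu * Mv * (t - s) ^ (-(1 / 2 : ℝ)) := by
  have h := norm_oseenFlatC_le_of_region hR.hC hR.hC0.le hR.hL₀0 hR.hL₀ hR.hLip hR.hCH0 hR.hCH hR.hc hR.hc1 hR.hcL hs hst (by linarith)
    hMu0 hMv0 huM hvM hU hV hUM hVM hUres hVres hζ
  rw [div_eq_mul_inv, inv_sqrt_eq_rpow_neg_half' (sub_pos.2 hst)] at h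
  calc _ ≤ _ := h
    _ = _ := by ring

/-- **The induction** `P(n)`: for every `s ∈ (s₀, t₁)`, `Wⁿ(s, ·)` is holomorphic on `Ω_s`,
bounded there by `ρ₀`, and restricts to `wⁿ(s, ·)` at every real point.
[cite: BradshawGrujicKukavica2015, Thm. 2.3 (proof, §3–§4)] -/
theorem picardW_spec (n : ℕ) :
    ∀ s ∈ Ioo s₀ t₁, DifferentiableOn ℂ (picardW s₀ DATA DATAC n s) (region x₁ c s₀ s) ∧
      (∀ ζ ∈ region x₁ c s₀ s, ‖picardW s₀ DATA DATAC n s ζ‖ ≤ ρ₀) ∧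
      ∀ x, picardW s₀ DATA DATAC n s (complexify x) = complexify (oseenPicard s₀ DATA n s x) := by
  have hc := hR.hc; have hL₀0 := hR.hL₀0; have hCH0 := hR.hCH0; have hC0 := hR.hC0
  have hD0 := hR.datum.nonneg; have hρD := hR.hρD
  have hρ0 : 0 ≤ ρ₀ := by linarith [hR.datum.nonneg]
  set Λ : ℝ := (1 + c * Real.sqrt (t₁ - s₀) * L₀ * (1 + 2 * C_H)) * C with hΛ
  have hΛ0 : 0 < Λ := by positivity
  induction n with
  | zero =>
    intro s _
    refine ⟨differentiableOn_const _, fun ζ _ => by simp [hρ0], fun x => by simp⟩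
  | succ n ih =>
    intro t ht
    -- the real iterate `wₙ`: slab measurability and bound
    obtain ⟨hwmeas, hwb⟩ := oseenPicard_measurable_and_bound hR.datum.meas hR.datum.nonneg hR.datum.bound hR.hCB0 hR.hCB hR.hsmallR n
    set w := oseenPicard s₀ DATA n with hw
    have hwρ : ∀ s ∈ Ioo s₀ t₁, ∀ x, ‖w s x‖ ≤ ρ₀ := fun s hs x => (hwb s hs x).trans hR.hρD
    -- slab data on `(s₀, t)`
    have hsub : Ioo s₀ t ×ˢ (univ : Set (EuclideanSpace ℝ (Fin 3))) ⊆ Ioo s₀ t₁ ×ˢ univ :=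
      prod_mono (Ioo_subset_Ioo_right ht.2.le) subset_rfl
    have hwmeas_t : AEStronglyMeasurable (uncurry w)
        ((volume : Measure (ℝ × EuclideanSpace ℝ (Fin 3))).restrict (Ioo s₀ t ×ˢ univ)) :=
      hwmeas.mono_measure (Measure.restrict_mono hsub le_rfl)
    have hwb_t : ∀ s ∈ Ioo s₀ t, ∀ x, ‖w s x‖ ≤ ρ₀ := fun s hs x => hwρ s ⟨hs.1, hs.2.trans ht.2⟩ x
    -- the slice bound on `Ω_t`
    have hslice : ∀ ζ ∈ region x₁ c s₀ t, ∀ s ∈ Ioo s₀ t,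
        ‖oseenFlatC (Real.sqrt (t - s)) (w s) (w s) ζ‖ ≤ Λ * ρ₀ * ρ₀ * (t - s) ^ (-(1 / 2 : ℝ)) := by
      intro ζ hζ s hs
      obtain ⟨hhol, hbd, hres⟩ := ih s ⟨hs.1, hs.2.trans ht.2⟩
      exact norm_slice_le hR
        hs.1 hs.2 ht.2.le hρ0 hρ0 (hwb_t s hs) (hwb_t s hs) hhol hhol hbd hbd
        (fun x _ => hres x) (fun x _ => hres x) hζ
    refine ⟨?_, ?_, ?_⟩
    · -- holomorphy: `DATA_ℂ` minus the dominated flat Duhamel term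
      have hflat : DifferentiableOn ℂ (oseenDuhamelFlatC s₀ w w t) (region x₁ c s₀ t) := by
        intro ζ₀ hζ₀
        obtain ⟨x₀, y₀, rfl, -, -, -, -, -⟩ := mem_region hζ₀
        set V' := region x₁ c s₀ t ∩ ball (complexify x₀ + Complex.I • complexify y₀) 1 with hV'
        have hV'o : IsOpen V' := (isOpen_region _ _ _ _).inter isOpen_ball
        have hmem : complexify x₀ + Complex.I • complexify y₀ ∈ V' := ⟨hζ₀, mem_ball_self one_pos⟩
        have hd : DifferentiableOn ℂ (oseenDuhamelFlatC s₀ w w t) V' := by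
          refine differentiableOn_oseenDuhamelFlatC hwmeas_t hwmeas_t hρ0 hwb_t hwb_t x₀
            (show (0 : ℝ) ≤ c * Real.sqrt (t - s₀) by positivity) hV'o (fun ζ hζ => ?_)
            ((integrableOn_Ioo_sub_rpow_neg_half' s₀ t).const_mul (Λ * ρ₀ * ρ₀)) (fun ζ hζ s hs => hslice ζ hζ.1 s hs)
          obtain ⟨x, y, rfl, -, -, -, hyκ, -⟩ := mem_region hζ.1
          refine ⟨x, y, rfl, ?_, hyκ.le⟩
          have hb := mem_ball.1 hζ.2
          rw [dist_eq_norm] at hb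
          exact (norm_re_sub_re_le' x y x₀ y₀).trans hb.le
        exact (hd.differentiableAt (hV'o.mem_nhds hmem)).differentiableWithinAt
      have h := (hR.datum.holo t ht).sub hflat
      exact h.congr fun ζ _ => by rw [picardW_succ]; rfl
    · -- the bound
      intro ζ hζ
      rw [picardW_succ]
      have hflat := norm_oseenDuhamelFlatC_le_of_forall ht.1 (by positivity : 0 ≤ Λ * ρ₀ * ρ₀) (hslice ζ hζ)
      have hsqrt : Real.sqrt (t - s₀) ≤ Real.sqrt (t₁ - s₀) := Real.sqrt_le_sqrt (by linarith [ht.2])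
      calc ‖DATAC t ζ - oseenDuhamelFlatC s₀ w w t ζ‖ ≤ ‖DATAC t ζ‖ + ‖oseenDuhamelFlatC s₀ w w t ζ‖ := norm_sub_le _ _
        _ ≤ D₀' + Λ * ρ₀ * ρ₀ * (2 * Real.sqrt (t - s₀)) := add_le_add (hR.datum.boundC t ht ζ hζ) hflat
        _ ≤ D₀' + Λ * ρ₀ * ρ₀ * (2 * Real.sqrt (t₁ - s₀)) := by gcongr
        _ = D₀' + (1 + c * Real.sqrt (t₁ - s₀) * L₀ * (1 + 2 * C_H)) * C * ρ₀ ^ 2 * (2 * Real.sqrt (t₁ - s₀)) := by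
            rw [hΛ]; ring
        _ ≤ ρ₀ := hR.hρ
    · -- the real trace
      intro x
      rw [picardW_succ, oseenPicard_succ, hR.datum.real t ht x, oseenDuhamelFlatC_complexify, map_sub]

/-- **The real trace of the iterates** (extracted). [folklore] -/
theorem picardW_complexify (n : ℕ) {s : ℝ} (hs : s ∈ Ioo s₀ t₁) (x : EuclideanSpace ℝ (Fin 3)) :
    picardW s₀ DATA DATAC n s (complexify x) = complexify (oseenPicard s₀ DATA n s x) :=
  (picardW_spec hR n s hs).2.2 x

/-! ### Contraction of consecutive differences -/

/-- **Bilinearity of the flat slice in its densities** (all four flat integrands integrable):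
`♭(a,a) - ♭(b,b) = ♭(a - b, a) + ♭(b, a - b)`. [folklore] -/
theorem oseenFlatC_self_sub_self {a b : EuclideanSpace ℝ (Fin 3) → EuclideanSpace ℝ (Fin 3)}
    (ha : AEStronglyMeasurable a volume) (hb : AEStronglyMeasurable b volume)
    {M : ℝ} (hM : 0 ≤ M) (haM : ∀ w, ‖a w‖ ≤ M) (hbM : ∀ w, ‖b w‖ ≤ M)
    {ρ : ℝ} (hρ' : 0 < ρ) (x y : EuclideanSpace ℝ (Fin 3)) :
    oseenFlatC ρ a a (complexify x + Complex.I • complexify y) - oseenFlatC ρ b b (complexify x + Complex.I • complexify y) =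
      oseenFlatC ρ (fun w => a w - b w) a (complexify x + Complex.I • complexify y) +
        oseenFlatC ρ b (fun w => a w - b w) (complexify x + Complex.I • complexify y) := by
  have _ := hR
  have habM : ∀ w, ‖a w - b w‖ ≤ 2 * M := fun w => (norm_sub_le _ _).trans (by linarith [haM w, hbM w])
  have hab : AEStronglyMeasurable (fun w => a w - b w) volume := ha.sub hb
  have i1 := integrable_oseenFlatC_integrand ha ha hM hM haM haM hρ' x y
  have i2 := integrable_oseenFlatC_integrand hb hb hM hM hbM hbM hρ' x y
  have i3 := integrable_oseenFlatC_integrand hab ha (by positivity) hM habM haM hρ' x y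
  have i4 := integrable_oseenFlatC_integrand hb hab hM (by positivity) hbM habM hρ' x y
  simp only [oseenFlatC_apply]
  rw [← integral_sub i1 i2, ← integral_add i3 i4]
  refine integral_congr_ae (Eventually.of_forall fun w => ?_)
  simp only [map_sub, oseenKernelC_sub_left, oseenKernelC_sub_right]
  abel

/-- **Consecutive differences contract**: for every `s ∈ (s₀, t₁)`,
`‖Wⁿ⁺¹(s, ζ) - Wⁿ(s, ζ)‖ ≤ ρ₀ 2⁻ⁿ` on `Ω_s` and `‖wⁿ⁺¹(s, x) - wⁿ(s, x)‖ ≤ ρ₀ 2⁻ⁿ` for all `x`.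
[cite: BradshawGrujicKukavica2015, Thm. 2.3 (proof)] -/
theorem norm_picardW_succ_sub_le (n : ℕ) :
    ∀ s ∈ Ioo s₀ t₁, (∀ ζ ∈ region x₁ c s₀ s,
        ‖picardW s₀ DATA DATAC (n + 1) s ζ - picardW s₀ DATA DATAC n s ζ‖ ≤ ρ₀ / 2 ^ n) ∧
      ∀ x, ‖oseenPicard s₀ DATA (n + 1) s x - oseenPicard s₀ DATA n s x‖ ≤ ρ₀ / 2 ^ n := by
  have hc := hR.hc; have hL₀0 := hR.hL₀0; have hCH0 := hR.hCH0; have hC0 := hR.hC0; have hCB0 := hR.hCB0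
  have hD0 := hR.datum.nonneg; have hρD := hR.hρD; have hsmallR := hR.hsmallR
  have hρ0 : 0 ≤ ρ₀ := by linarith [hR.datum.nonneg]
  set Λ : ℝ := (1 + c * Real.sqrt (t₁ - s₀) * L₀ * (1 + 2 * C_H)) * C with hΛ
  have hΛ0 : 0 < Λ := by positivity
  have hspec := picardW_spec hR
  have hPic := fun n => oseenPicard_measurable_and_bound hR.datum.meas hR.datum.nonneg hR.datum.bound hR.hCB0 hR.hCB hR.hsmallR n
  induction n with
  | zero =>
    intro s hs
    refine ⟨fun ζ hζ => ?_, fun x => ?_⟩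
    · rw [picardW_succ, picardW_zero, sub_zero, pow_zero, div_one]
      have h0 : oseenDuhamelFlatC s₀ (oseenPicard s₀ DATA 0) (oseenPicard s₀ DATA 0) s ζ = 0 := by
        rw [oseenDuhamelFlatC_apply]
        refine (setIntegral_congr_fun measurableSet_Ioo fun τ _ => ?_).trans (MeasureTheory.integral_zero _ _)
        · rw [oseenFlatC_apply]
          refine (MeasureTheory.integral_congr_ae (Eventually.of_forall fun w => ?_)).trans (MeasureTheory.integral_zero _ _)
          show oseenKernelC _ _ (complexify (oseenPicard s₀ DATA 0 τ w)) (complexify (oseenPicard s₀ DATA 0 τ w)) = 0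
          rw [oseenPicard_zero, oseenKernelC_complexify_zero_left]
      rw [h0]
      simp only [sub_zero]
      calc ‖DATAC s ζ‖ ≤ D₀' := hR.datum.boundC s hs ζ hζ
        _ ≤ ρ₀ := by
            have : 0 ≤ (1 + c * Real.sqrt (t₁ - s₀) * L₀ * (1 + 2 * C_H)) * C * ρ₀ ^ 2 * (2 * Real.sqrt (t₁ - s₀)) := by
              positivity
            linarith [hR.hρ]
    · rw [oseenPicard_succ, oseenPicard_zero, pow_zero, div_one]
      have h0 : oseenDuhamel 1 s₀ (oseenPicard s₀ DATA 0) (oseenPicard s₀ DATA 0) s x = 0 := by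
        rw [oseenDuhamel_apply]
        refine (setIntegral_congr_fun measurableSet_Ioo fun τ _ => ?_).trans (MeasureTheory.integral_zero _ _)
        refine (MeasureTheory.integral_congr_ae (Eventually.of_forall fun w => ?_)).trans (MeasureTheory.integral_zero _ _)
        show oseenKernel _ _ (oseenPicard s₀ DATA 0 τ w) (oseenPicard s₀ DATA 0 τ w) = 0
        rw [oseenPicard_zero, oseenKernel_zero_left]
      rw [h0]
      simp only [sub_zero]
      linarith [hR.datum.bound s hs x, hR.datum.nonneg]
  | succ n ih =>
    intro t ht
    have hd0 : 0 ≤ ρ₀ / 2 ^ n := by positivity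
    obtain ⟨hm1, hb1⟩ := hPic (n + 1)
    obtain ⟨hm0, hb0⟩ := hPic n
    have haρ : ∀ s ∈ Ioo s₀ t₁, ∀ x, ‖oseenPicard s₀ DATA (n + 1) s x‖ ≤ ρ₀ := fun s hs x => (hb1 s hs x).trans hR.hρD
    have hbρ : ∀ s ∈ Ioo s₀ t₁, ∀ x, ‖oseenPicard s₀ DATA n s x‖ ≤ ρ₀ := fun s hs x => (hb0 s hs x).trans hR.hρD
    -- slab restriction to `(s₀, t)`
    have hsub : Ioo s₀ t ×ˢ (univ : Set (EuclideanSpace ℝ (Fin 3))) ⊆ Ioo s₀ t₁ ×ˢ univ :=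
      prod_mono (Ioo_subset_Ioo_right ht.2.le) subset_rfl
    have hm1t := hm1.mono_measure (Measure.restrict_mono hsub le_rfl)
    have hm0t := hm0.mono_measure (Measure.restrict_mono hsub le_rfl)
    have hmdt : AEStronglyMeasurable (uncurry fun s x => oseenPicard s₀ DATA (n + 1) s x - oseenPicard s₀ DATA n s x)
        ((volume : Measure (ℝ × EuclideanSpace ℝ (Fin 3))).restrict (Ioo s₀ t ×ˢ univ)) := hm1t.sub hm0t
    have hsqrt : Real.sqrt (t - s₀) ≤ Real.sqrt (t₁ - s₀) := Real.sqrt_le_sqrt (by linarith [ht.2])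
    refine ⟨fun ζ hζ => ?_, fun x => ?_⟩
    · -- complex differences
      obtain ⟨x, y, rfl, hx, hψx, hyψ, hyκ, hκ⟩ := mem_region hζ
      have heq : picardW s₀ DATA DATAC (n + 1 + 1) t (complexify x + Complex.I • complexify y) -
          picardW s₀ DATA DATAC (n + 1) t (complexify x + Complex.I • complexify y) =
          -(oseenDuhamelFlatC s₀ (oseenPicard s₀ DATA (n + 1)) (oseenPicard s₀ DATA (n + 1)) t
              (complexify x + Complex.I • complexify y) -
            oseenDuhamelFlatC s₀ (oseenPicard s₀ DATA n) (oseenPicard s₀ DATA n) t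
              (complexify x + Complex.I • complexify y)) := by
        rw [picardW_succ s₀ DATA DATAC (n + 1), picardW_succ s₀ DATA DATAC n]
        abel
      -- slice bounds for the two difference terms
      have hsl1 : ∀ s ∈ Ioo s₀ t, ‖oseenFlatC (Real.sqrt (t - s))
          (fun w => oseenPicard s₀ DATA (n + 1) s w - oseenPicard s₀ DATA n s w) (oseenPicard s₀ DATA (n + 1) s)
          (complexify x + Complex.I • complexify y)‖ ≤ Λ * (ρ₀ / 2 ^ n) * ρ₀ * (t - s) ^ (-(1 / 2 : ℝ)) := by
        intro s hs
        have hs₁ : s ∈ Ioo s₀ t₁ := ⟨hs.1, hs.2.trans ht.2⟩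
        obtain ⟨hU1, hB1, hR1⟩ := hspec (n + 1) s hs₁
        obtain ⟨hU0, -, hR0⟩ := hspec n s hs₁
        obtain ⟨hdiffC, hdiffR⟩ := ih s hs₁
        exact norm_slice_le hR
          hs.1 hs.2 ht.2.le hd0 hρ0 hdiffR (haρ s hs₁) (hU1.sub hU0) hU1
          (fun ξ hξ => hdiffC ξ hξ) hB1 (fun z _ => by rw [Pi.sub_apply, hR1 z, hR0 z, map_sub]) (fun z _ => hR1 z) hζ
      have hsl2 : ∀ s ∈ Ioo s₀ t, ‖oseenFlatC (Real.sqrt (t - s)) (oseenPicard s₀ DATA n s)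
          (fun w => oseenPicard s₀ DATA (n + 1) s w - oseenPicard s₀ DATA n s w)
          (complexify x + Complex.I • complexify y)‖ ≤ Λ * ρ₀ * (ρ₀ / 2 ^ n) * (t - s) ^ (-(1 / 2 : ℝ)) := by
        intro s hs
        have hs₁ : s ∈ Ioo s₀ t₁ := ⟨hs.1, hs.2.trans ht.2⟩
        obtain ⟨hU1, -, hR1⟩ := hspec (n + 1) s hs₁
        obtain ⟨hU0, hB0, hR0⟩ := hspec n s hs₁
        obtain ⟨hdiffC, hdiffR⟩ := ih s hs₁
        exact norm_slice_le hR
          hs.1 hs.2 ht.2.le hρ0 hd0 (hbρ s hs₁) hdiffR hU0 (hU1.sub hU0) hB0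
          (fun ξ hξ => hdiffC ξ hξ) (fun z _ => hR0 z) (fun z _ => by rw [Pi.sub_apply, hR1 z, hR0 z, map_sub]) hζ
      -- the flat Duhamel difference splits (a.e. in `s`, where the sections are measurable)
      have hprod : ((volume : Measure (ℝ × EuclideanSpace ℝ (Fin 3))).restrict (Ioo s₀ t ×ˢ univ)) =
          ((volume : Measure ℝ).restrict (Ioo s₀ t)).prod (volume : Measure (EuclideanSpace ℝ (Fin 3))) := by
        rw [volume_restrict_prod_univ]
      have has : ∀ᵐ s ∂((volume : Measure ℝ).restrict (Ioo s₀ t)),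
          AEStronglyMeasurable (oseenPicard s₀ DATA (n + 1) s) volume := by
        have h := hm1t; rw [hprod] at h
        filter_upwards [h.prodMk_left] with s hs using hs
      have hbs : ∀ᵐ s ∂((volume : Measure ℝ).restrict (Ioo s₀ t)),
          AEStronglyMeasurable (oseenPicard s₀ DATA n s) volume := by
        have h := hm0t; rw [hprod] at h
        filter_upwards [h.prodMk_left] with s hs using hs
      have hae : ∀ᵐ s ∂((volume : Measure ℝ).restrict (Ioo s₀ t)), s ∈ Ioo s₀ t := ae_restrict_mem measurableSet_Ioo
      -- integrability in `s` of the four slice families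
      have hIa : Integrable (fun s => oseenFlatC (Real.sqrt (t - s)) (oseenPicard s₀ DATA (n + 1) s)
          (oseenPicard s₀ DATA (n + 1) s) (complexify x + Complex.I • complexify y))
          ((volume : Measure ℝ).restrict (Ioo s₀ t)) := by
        refine Integrable.mono' (((integrableOn_Ioo_sub_rpow_neg_half' s₀ t).const_mul (Λ * ρ₀ * ρ₀)))
          (aestronglyMeasurable_oseenFlatC_time hm1t hm1t _) ?_
        filter_upwards [hae] with s hs
        obtain ⟨hU1, hB1, hR1⟩ := hspec (n + 1) s ⟨hs.1, hs.2.trans ht.2⟩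
        exact norm_slice_le hR
          hs.1 hs.2 ht.2.le hρ0 hρ0 (haρ s ⟨hs.1, hs.2.trans ht.2⟩) (haρ s ⟨hs.1, hs.2.trans ht.2⟩) hU1 hU1 hB1 hB1
          (fun z _ => hR1 z) (fun z _ => hR1 z) hζ
      have hIb : Integrable (fun s => oseenFlatC (Real.sqrt (t - s)) (oseenPicard s₀ DATA n s)
          (oseenPicard s₀ DATA n s) (complexify x + Complex.I • complexify y))
          ((volume : Measure ℝ).restrict (Ioo s₀ t)) := by
        refine Integrable.mono' (((integrableOn_Ioo_sub_rpow_neg_half' s₀ t).const_mul (Λ * ρ₀ * ρ₀)))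
          (aestronglyMeasurable_oseenFlatC_time hm0t hm0t _) ?_
        filter_upwards [hae] with s hs
        obtain ⟨hU0, hB0, hR0⟩ := hspec n s ⟨hs.1, hs.2.trans ht.2⟩
        exact norm_slice_le hR
          hs.1 hs.2 ht.2.le hρ0 hρ0 (hbρ s ⟨hs.1, hs.2.trans ht.2⟩) (hbρ s ⟨hs.1, hs.2.trans ht.2⟩) hU0 hU0 hB0 hB0
          (fun z _ => hR0 z) (fun z _ => hR0 z) hζ
      have hI1 : Integrable (fun s => oseenFlatC (Real.sqrt (t - s))
          (fun w => oseenPicard s₀ DATA (n + 1) s w - oseenPicard s₀ DATA n s w) (oseenPicard s₀ DATA (n + 1) s)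
          (complexify x + Complex.I • complexify y)) ((volume : Measure ℝ).restrict (Ioo s₀ t)) := by
        refine Integrable.mono' (((integrableOn_Ioo_sub_rpow_neg_half' s₀ t).const_mul (Λ * (ρ₀ / 2 ^ n) * ρ₀)))
          (aestronglyMeasurable_oseenFlatC_time hmdt hm1t _) ?_
        filter_upwards [hae] with s hs using hsl1 s hs
      have hI2 : Integrable (fun s => oseenFlatC (Real.sqrt (t - s)) (oseenPicard s₀ DATA n s)
          (fun w => oseenPicard s₀ DATA (n + 1) s w - oseenPicard s₀ DATA n s w)
          (complexify x + Complex.I • complexify y)) ((volume : Measure ℝ).restrict (Ioo s₀ t)) := by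
        refine Integrable.mono' (((integrableOn_Ioo_sub_rpow_neg_half' s₀ t).const_mul (Λ * ρ₀ * (ρ₀ / 2 ^ n))))
          (aestronglyMeasurable_oseenFlatC_time hm0t hmdt _) ?_
        filter_upwards [hae] with s hs using hsl2 s hs
      have hsplit : oseenDuhamelFlatC s₀ (oseenPicard s₀ DATA (n + 1)) (oseenPicard s₀ DATA (n + 1)) t
            (complexify x + Complex.I • complexify y) -
          oseenDuhamelFlatC s₀ (oseenPicard s₀ DATA n) (oseenPicard s₀ DATA n) t (complexify x + Complex.I • complexify y) =
          oseenDuhamelFlatC s₀ (fun s w => oseenPicard s₀ DATA (n + 1) s w - oseenPicard s₀ DATA n s w)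
            (oseenPicard s₀ DATA (n + 1)) t (complexify x + Complex.I • complexify y) +
          oseenDuhamelFlatC s₀ (oseenPicard s₀ DATA n)
            (fun s w => oseenPicard s₀ DATA (n + 1) s w - oseenPicard s₀ DATA n s w) t
            (complexify x + Complex.I • complexify y) := by
        simp only [oseenDuhamelFlatC_apply]
        rw [← integral_sub hIa hIb, ← integral_add hI1 hI2]
        refine integral_congr_ae ?_
        filter_upwards [hae, has, hbs] with s hs has' hbs'
        exact oseenFlatC_self_sub_self hR
          has' hbs' hρ0 (haρ s ⟨hs.1, hs.2.trans ht.2⟩) (hbρ s ⟨hs.1, hs.2.trans ht.2⟩)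
          (Real.sqrt_pos.2 (sub_pos.2 hs.2)) x y
      rw [heq, norm_neg, hsplit]
      have h1 := norm_oseenDuhamelFlatC_le_of_forall ht.1 (by positivity : 0 ≤ Λ * (ρ₀ / 2 ^ n) * ρ₀) hsl1
      have h2 := norm_oseenDuhamelFlatC_le_of_forall ht.1 (by positivity : 0 ≤ Λ * ρ₀ * (ρ₀ / 2 ^ n)) hsl2
      calc _ ≤ Λ * (ρ₀ / 2 ^ n) * ρ₀ * (2 * Real.sqrt (t - s₀)) + Λ * ρ₀ * (ρ₀ / 2 ^ n) * (2 * Real.sqrt (t - s₀)) :=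
            (norm_add_le _ _).trans (add_le_add h1 h2)
        _ = 2 * (Λ * ρ₀ * (2 * Real.sqrt (t - s₀))) * (ρ₀ / 2 ^ n) := by ring
        _ ≤ 2 * (Λ * ρ₀ * (2 * Real.sqrt (t₁ - s₀))) * (ρ₀ / 2 ^ n) := by gcongr
        _ ≤ 2 * (1 / 8) * (ρ₀ / 2 ^ n) := by
            have hcontr' : Λ * ρ₀ * (2 * Real.sqrt (t₁ - s₀)) ≤ 1 / 8 := by rw [hΛ]; exact hR.hcontr
            gcongr
        _ ≤ ρ₀ / 2 ^ n / 2 := by linarith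
        _ = ρ₀ / 2 ^ (n + 1) := by rw [pow_succ]; ring
    · -- real differences
      have heq : oseenPicard s₀ DATA (n + 1 + 1) t x - oseenPicard s₀ DATA (n + 1) t x =
          -(oseenDuhamel 1 s₀ (oseenPicard s₀ DATA (n + 1)) (oseenPicard s₀ DATA (n + 1)) t x -
            oseenDuhamel 1 s₀ (oseenPicard s₀ DATA n) (oseenPicard s₀ DATA n) t x) := by
        rw [oseenPicard_succ s₀ DATA (n + 1), oseenPicard_succ s₀ DATA n]
        abel
      have hD2 : 0 ≤ 2 * D₀ := by linarith [hR.datum.nonneg]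
      have hb1t : ∀ s ∈ Ioo s₀ t, ∀ y, ‖oseenPicard s₀ DATA (n + 1) s y‖ ≤ 2 * D₀ := fun s hs y =>
        hb1 s ⟨hs.1, hs.2.trans ht.2⟩ y
      have hb0t : ∀ s ∈ Ioo s₀ t, ∀ y, ‖oseenPicard s₀ DATA n s y‖ ≤ 2 * D₀ := fun s hs y =>
        hb0 s ⟨hs.1, hs.2.trans ht.2⟩ y
      have hbdt : ∀ s ∈ Ioo s₀ t, ∀ y, ‖oseenPicard s₀ DATA (n + 1) s y - oseenPicard s₀ DATA n s y‖ ≤ ρ₀ / 2 ^ n :=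
        fun s hs y => (ih s ⟨hs.1, hs.2.trans ht.2⟩).2 y
      have hsplit : oseenDuhamel 1 s₀ (oseenPicard s₀ DATA (n + 1)) (oseenPicard s₀ DATA (n + 1)) t x -
          oseenDuhamel 1 s₀ (oseenPicard s₀ DATA n) (oseenPicard s₀ DATA n) t x =
          oseenDuhamel 1 s₀ (fun s y => oseenPicard s₀ DATA (n + 1) s y - oseenPicard s₀ DATA n s y)
            (oseenPicard s₀ DATA (n + 1)) t x +
          oseenDuhamel 1 s₀ (oseenPicard s₀ DATA n)
            (fun s y => oseenPicard s₀ DATA (n + 1) s y - oseenPicard s₀ DATA n s y) t x := by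
        rw [oseenDuhamel_sub_left one_pos hm1t hm0t hm1t hb1t hb0t hb1t ht.1 le_rfl x,
          oseenDuhamel_sub_right one_pos hm0t hm1t hm0t hb0t hb1t hb0t ht.1 le_rfl x]
        abel
      have h1 := hR.hCB ht.1 hd0 hD2 hbdt hb1t x
      have h2 := hR.hCB ht.1 hD2 hd0 hb0t hbdt x
      rw [Real.one_rpow, mul_one] at h1 h2
      rw [heq, norm_neg, hsplit]
      calc _ ≤ C_B * (ρ₀ / 2 ^ n) * (2 * D₀) * (2 * Real.sqrt (t - s₀)) +
            C_B * (2 * D₀) * (ρ₀ / 2 ^ n) * (2 * Real.sqrt (t - s₀)) := (norm_add_le _ _).trans (add_le_add h1 h2)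
        _ = 2 * (C_B * (2 * D₀) * (2 * Real.sqrt (t - s₀))) * (ρ₀ / 2 ^ n) := by ring
        _ ≤ 2 * (C_B * (2 * D₀) * (2 * Real.sqrt (t₁ - s₀))) * (ρ₀ / 2 ^ n) := by gcongr
        _ ≤ 2 * (1 / 4) * (ρ₀ / 2 ^ n) := by gcongr
        _ = ρ₀ / 2 ^ n / 2 := by ring
        _ = ρ₀ / 2 ^ (n + 1) := by rw [pow_succ]; ring

/-! ### The limit -/

omit hR in
/-- **The limit of the complex iterates** (pointwise `limUnder`). [folklore] -/
def picardWLim (s₀ : ℝ) (DATA : ℝ → EuclideanSpace ℝ (Fin 3) → EuclideanSpace ℝ (Fin 3))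
    (DATAC : ℝ → EuclideanSpace ℂ (Fin 3) → EuclideanSpace ℂ (Fin 3)) (t : ℝ) (ζ : EuclideanSpace ℂ (Fin 3)) :
    EuclideanSpace ℂ (Fin 3) :=
  limUnder atTop fun n => picardW s₀ DATA DATAC n t ζ

/-- The increments in Mathlib's `C/2/2^n` form. [folklore] -/
theorem dist_picardW_succ_le (n : ℕ) {t : ℝ} (ht : t ∈ Ioo s₀ t₁) {ζ : EuclideanSpace ℂ (Fin 3)}
    (hζ : ζ ∈ region x₁ c s₀ t) :
    dist (picardW s₀ DATA DATAC n t ζ) (picardW s₀ DATA DATAC (n + 1) t ζ) ≤ 2 * ρ₀ / 2 / 2 ^ n := by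
  rw [dist_comm, dist_eq_norm, show 2 * ρ₀ / 2 / 2 ^ n = ρ₀ / 2 ^ n by ring]
  exact (norm_picardW_succ_sub_le hR n t ht).1 ζ hζ

/-- **Pointwise convergence** of the complex iterates on `Ω_t`. [folklore] -/
theorem tendsto_picardW {t : ℝ} (ht : t ∈ Ioo s₀ t₁) {ζ : EuclideanSpace ℂ (Fin 3)} (hζ : ζ ∈ region x₁ c s₀ t) :
    Tendsto (fun n => picardW s₀ DATA DATAC n t ζ) atTop (𝓝 (picardWLim s₀ DATA DATAC t ζ)) :=
  (cauchySeq_of_le_geometric_two (fun n => dist_picardW_succ_le hR n ht hζ)).tendsto_limUnder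

/-- **Uniform geometric rate**: `‖Wⁿ(t, ζ) - W(t, ζ)‖ ≤ 2ρ₀ 2⁻ⁿ` on `Ω_t`. [folklore] -/
theorem norm_picardW_sub_lim_le (n : ℕ) {t : ℝ} (ht : t ∈ Ioo s₀ t₁) {ζ : EuclideanSpace ℂ (Fin 3)}
    (hζ : ζ ∈ region x₁ c s₀ t) :
    ‖picardW s₀ DATA DATAC n t ζ - picardWLim s₀ DATA DATAC t ζ‖ ≤ 2 * ρ₀ / 2 ^ n := by
  rw [← dist_eq_norm]
  exact dist_le_of_le_geometric_two_of_tendsto (fun n => dist_picardW_succ_le hR n ht hζ) (tendsto_picardW hR ht hζ) n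

/-- **Uniform convergence on `Ω_t`.** [folklore] -/
theorem tendstoUniformlyOn_picardW {t : ℝ} (ht : t ∈ Ioo s₀ t₁) :
    TendstoUniformlyOn (fun n ζ => picardW s₀ DATA DATAC n t ζ) (picardWLim s₀ DATA DATAC t) atTop
      (region x₁ c s₀ t) := by
  have hrate : Tendsto (fun n : ℕ => 2 * ρ₀ / 2 ^ n) atTop (𝓝 0) :=
    tendsto_const_nhds.div_atTop (tendsto_pow_atTop_atTop_of_one_lt one_lt_two)
  rw [Metric.tendstoUniformlyOn_iff]
  intro ε hε
  filter_upwards [hrate.eventually (gt_mem_nhds hε)] with n hn ζ hζ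
  rw [dist_comm, dist_eq_norm]
  exact (norm_picardW_sub_lim_le hR n ht hζ).trans_lt hn

/-- **The limit is holomorphic on `Ω_t`** (Weierstrass' theorem in several complex variables).
[cite: HormanderSCV1973, §2.2 Cor. 2.2.5] -/
theorem differentiableOn_picardWLim {t : ℝ} (ht : t ∈ Ioo s₀ t₁) :
    DifferentiableOn ℂ (picardWLim s₀ DATA DATAC t) (region x₁ c s₀ t) :=
  Literature.Analysis.Complex.SCV.differentiableOn_of_tendstoLocallyUniformlyOn (isOpen_region _ _ _ _)
    (fun n => (picardW_spec hR n t ht).1) (tendstoUniformlyOn_picardW hR ht).tendstoLocallyUniformlyOn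

/-- **The limit restricts to the bounded fixed point at the real points of `Ω_t`**: if `v` is
jointly measurable on the slab, bounded by `2D₀`, and `v = DATA - B_{s₀}(v, v)` there, then
`W(t, cx x) = cx v(t, x)` whenever `cx x ∈ Ω_t`. [cite: LemarieRieusset2016, Thm. 5.1 (proof)] -/
theorem picardWLim_complexify {v : ℝ → EuclideanSpace ℝ (Fin 3) → EuclideanSpace ℝ (Fin 3)}
    (hvm : AEStronglyMeasurable (uncurry v)
      ((volume : Measure (ℝ × EuclideanSpace ℝ (Fin 3))).restrict (Ioo s₀ t₁ ×ˢ univ)))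
    (hvb : ∀ t ∈ Ioo s₀ t₁, ∀ x, ‖v t x‖ ≤ 2 * D₀)
    (hfix : ∀ t ∈ Ioo s₀ t₁, ∀ x, v t x = DATA t x - oseenDuhamel 1 s₀ v v t x)
    {t : ℝ} (ht : t ∈ Ioo s₀ t₁) {x : EuclideanSpace ℝ (Fin 3)} (hx : complexify x ∈ region x₁ c s₀ t) :
    picardWLim s₀ DATA DATAC t (complexify x) = complexify (v t x) := by
  have h1 := tendsto_picardW hR ht hx
  -- the real iterates converge to `v`
  have hreal : Tendsto (fun n => picardW s₀ DATA DATAC n t (complexify x)) atTop (𝓝 (complexify (v t x))) := by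
    have hrate : Tendsto (fun n : ℕ => 4 * D₀ * (1 / 2 : ℝ) ^ n) atTop (𝓝 0) := by
      have h := (tendsto_pow_atTop_nhds_zero_of_lt_one (by norm_num : (0 : ℝ) ≤ 1 / 2) (by norm_num)).const_mul (4 * D₀)
      rwa [mul_zero] at h
    have hw := norm_oseenPicard_sub_le hR.datum.meas hR.datum.nonneg hR.datum.bound hR.hCB0 hR.hCB hR.hsmallR hvm hvb hfix
    rw [tendsto_iff_norm_sub_tendsto_zero]
    refine squeeze_zero (fun n => norm_nonneg _) (fun n => ?_) hrate
    rw [picardW_complexify hR n ht x, ← map_sub, norm_complexify]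
    exact hw n t ht x
  exact tendsto_nhds_unique h1 hreal

/-- **The contour scheme produces a holomorphic extension of the bounded fixed point.** For a run
of the scheme and a jointly measurable `v`, bounded by `2D₀`, with `v = DATA - B_{s₀}(v,v)` on the
slab: for every `t ∈ (s₀, t₁)` there is `U` holomorphic on `Ω_t` with `U (cx x) = cx v(t, x)` at
the real points of `Ω_t`. [cite: BradshawGrujicKukavica2015, Thm. 2.3 (proof, §3–§4)] -/
theorem exists_differentiableOn_region_of_fixedPoint {v : ℝ → EuclideanSpace ℝ (Fin 3) → EuclideanSpace ℝ (Fin 3)}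
    (hvm : AEStronglyMeasurable (uncurry v)
      ((volume : Measure (ℝ × EuclideanSpace ℝ (Fin 3))).restrict (Ioo s₀ t₁ ×ˢ univ)))
    (hvb : ∀ t ∈ Ioo s₀ t₁, ∀ x, ‖v t x‖ ≤ 2 * D₀)
    (hfix : ∀ t ∈ Ioo s₀ t₁, ∀ x, v t x = DATA t x - oseenDuhamel 1 s₀ v v t x)
    {t : ℝ} (ht : t ∈ Ioo s₀ t₁) :
    ∃ U : EuclideanSpace ℂ (Fin 3) → EuclideanSpace ℂ (Fin 3), DifferentiableOn ℂ U (region x₁ c s₀ t) ∧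
      ∀ x, complexify x ∈ region x₁ c s₀ t → U (complexify x) = complexify (v t x) :=
  ⟨picardWLim s₀ DATA DATAC t, differentiableOn_picardWLim hR ht, fun _ hx => picardWLim_complexify hR hvm hvb hfix ht hx⟩

end Run

end BGK2015

end Literature.Analysis.FluidPDE
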